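import Mathlib
import HarnessLib
import Literature.MathematicalPhysics.StatisticalMechanics.RenormalisationMapRemaindersOneQ

/-!
# `K_{k+1}` with a FREE intermediate Hamiltonian `H̃`: the expansion, the outer split and the decomposition
# `nextK(μ_D; e^{−H}, e^{−H̃}, K)(U) = blockPart + Σ₁(H̃) + Σ₂ᴸ(H̃) + Σ₃(H̃) + Σ₄(H̃) + Σ₀(H̃)` ([ABKM19] Ch. 9.1)

[ABKM19] Definition 6.5 (6.34) defines `K_{k+1} = nextK s π μ_{k+1} I Ĩ K` with THREE functional slots:
`I = e^{−H}` (direct), `Ĩ = e^{−H̃}` (intermediate) and the activity `K`; the renormalisation map proper is the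
tied case `H̃ = nextH D H K = A_kH + B_kK` (`nextKStep`).  The second-order two-kernel estimate of
Lemma 12.6 (12.53) (`ℓ = 2`, slot (F4l2) of the route's crux child `TwoKernelSkBound`) varies the fluctuation
kernel and the intermediate Hamiltonian INDEPENDENTLY (blocks B1–B3 of the plan: `H̃`-parallelograms at fixed
kernel, kernel pairs at a common free `H̃`), so the algebraic skeleton of Theorem 6.8 is needed with `H̃` free.
Everything in `RenormalisationMapExpansion` / `RenormalisationMapSplit` / `RenormalisationMapRemainder` is
verbatim generic in `Ĩ` EXCEPT the first-order cancellation on single blocks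
(`FirstOrderCancellationBlock.firstOrder_block_identity`), which uses `H̃(B) = A_kH(B) + B_kK(B)`; with a free
`H̃` it leaves exactly one explicit single-block DEFECT term
`Σ₀(H̃) = Σ_{B̄ = U} p_B(H̃)·(e^{−(A_kH+B_kK)(B)} − e^{−H̃(B)})`, `p_X(H̃) = (e^{−H̃})^{U∖X}(e^{H̃})^{X∖U}`,
first order in `H̃ − (A_kH + B_kK)` and without any fluctuation integral.

* `nextK_freeHt_eq_sum` — (6.34) reblocked, `Ĩ = e^{−H̃}` free (twin of `nextKStep_eq_sum`);
* `nextK_freeHt_eq_split` — the outer split at `X₁ = ∅`, `X₁ = X` (twin of `nextKStep_eq_split`);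
* `nextK_freeHt_sub_opC_eq` — twin of `nextKStep_sub_opC_eq`: the four second-order sums with `H̃` in the
  prefactors and `(1 − e^{−H̃})`-factors, PLUS the defect sum `Σ₀(H̃)`;
* `nextK_freeHt_eq_blockPart_add_remainders_abkm_of_stepKernelBounds` — the torus discharge (kernel by
  predicate `StepKernelBounds`, twin of `nextKStep_eq_blockPart_add_remainders_abkm_of_stepKernelBounds`):
  `blockPart + Σ₁(H̃) + Σ₂ᴸ(H̃) + Σ₃(H̃) + Σ₄(H̃) + Σ₀(H̃)`, the four sums written exactly as the (free-`H̃`)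
  arguments of the one-kernel Lipschitz theorems (`RenormalisationMapRemaindersOneQ/TwoQ`) and of the
  kernel-only twins (`…KernelOnly`), which therefore apply to them unchanged.

At `H̃ = nextH D H K` the defect vanishes termwise and the statements reduce to the tied ones.  Everything is
proved; no named fact.  Use (honest scope): blocks B1–B3 of the stub `stub_f4l2ShrinkLoc` of the rung route
`Summits/HubbardSuperconductivity/…/Theses/ComplexGFFStiffness` (stiffness of a complex Gaussian gradient field
via the [ABKM19] RG); nothing about superconductivity in the Hubbard model is claimed or advanced.

## References
* S. Adams, S. Buchholz, R. Kotecký, S. Müller, *Cauchy–Born rule from microscopic models with non-convex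
  potentials*, arXiv:1910.13564 — Definition 6.5 (6.32)–(6.34), Theorem 6.8, Ch. 9.1, Ch. 10.1 (10.1)–(10.3),
  Lemma 12.6 (12.53) [AdamsBuchholzKoteckyMuller2019].
-/

noncomputable section

namespace Literature.MathematicalPhysics.StatisticalMechanics.GradientRG

open scoped BigOperators Classical
open Finset Matrix MeasureTheory
open Literature.MathematicalPhysics.StatisticalMechanics.TorusPolymer
  (IsPolymer blocks polys bprod blockOf thicken reblock boxCorner mem_polys mem_blocks numBlocks isPolymer_blockOf
    card_blocks_eq_numBlocks blocks_blockOf empty_mem_polys reblock_empty subset_thicken sum_large_regroup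
    bprod_empty blocks_empty blocks_mono closure bprod_blockOf)
open Literature.Barriers.CriticalPhenomena.LongRangePhi4.Polymer (IsConn components)
open Literature.MathematicalPhysics.QuantumFieldTheory

variable {d M : ℕ} [NeZero M]

/-! ## The reblocked expansion and the outer split with a free intermediate Hamiltonian -/

/-- **(6.34) reblocked, free `H̃`**: `nextK s π μ (e^{−H}) (e^{−H̃}) K (U, φ) = Σ_{X ∈ 𝓟_k, π(X) = U}
Σ_{X₁ ∈ 𝓟_k(X)} (e^{−H̃})^{U∖X}(φ) (e^{H̃})^{X∖U}(φ) · ((1 − e^{−H̃})^{X₁}(φ) · R[P₂(e^{−H},K)(X∖X₁)](φ))`,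
provided each `P₂(Z, φ + ·)` (`Z ∈ 𝓟_k`) is `μ`-integrable.
[cite: AdamsBuchholzKoteckyMuller2019, Definition 6.5 (6.34) / Ch. 9.1] -/
theorem nextK_freeHt_eq_sum (D : StepData d M) (H Ht : RelevantHamiltonian ℂ d)
    (K : Finset (Fin d → ZMod M) → ((Fin d → ZMod M) → ℝ) → ℂ) (U : Finset (Fin d → ZMod M))
    (φ : (Fin d → ZMod M) → ℝ)
    (hint : ∀ Z, IsPolymer D.s Z → Integrable (fun ξ => polyP2 D.s H K Z (φ + ξ)) (stepMeasure D.𝒞)) :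
    nextK D.s (reblock D.s (D.L * D.s)) (stepMeasure D.𝒞) (expNegH H) (expNegH Ht) K U φ =
      ∑ X ∈ (polys D.s univ).filter (fun X => reblock D.s (D.L * D.s) X = U), ∑ X₁ ∈ polys D.s X,
        bprod D.s (fun B => expNegH Ht B φ) (U \ X) *
          bprod D.s (fun B => expNegH (-Ht) B φ) (X \ U) *
          (bprod D.s (fun B => 1 - expNegH Ht B φ) X₁ *
            fluct D.𝒞 (polyP2 D.s H K (X \ X₁)) φ) := by
  unfold nextK
  refine Finset.sum_congr rfl fun X hX => ?_
  have hXp : IsPolymer D.s X := (mem_polys.1 (mem_filter.1 hX).1).2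
  rw [bprod_expNegH_inv, integral_midK_eq_sum H _ K _ hXp φ hint, Finset.mul_sum]
  rfl

/-- **The outer split, free `H̃`** (`U ≠ ∅`, `K(∅) = 1`):
`nextK(…)(U,φ) = Σ_{π(X)=U} p_X(H̃)·(R[P₂(X)](φ) + (1−e^{−H̃})^{X}(φ))
  + Σ_{π(X)=U} Σ_{X₁ ∈ 𝓟_k(X)∖{X,∅}} p_X(H̃)·((1−e^{−H̃})^{X₁}·R[P₂(X∖X₁)](φ))`.
[cite: AdamsBuchholzKoteckyMuller2019, Ch. 9.1] -/
theorem nextK_freeHt_eq_split (D : StepData d M) (H Ht : RelevantHamiltonian ℂ d)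
    (K : Finset (Fin d → ZMod M) → ((Fin d → ZMod M) → ℝ) → ℂ) (hK0 : ∀ φ, K ∅ φ = 1)
    {U : Finset (Fin d → ZMod M)} (hU : U.Nonempty) (φ : (Fin d → ZMod M) → ℝ)
    (hint : ∀ Z, IsPolymer D.s Z → Integrable (fun ξ => polyP2 D.s H K Z (φ + ξ)) (stepMeasure D.𝒞)) :
    nextK D.s (reblock D.s (D.L * D.s)) (stepMeasure D.𝒞) (expNegH H) (expNegH Ht) K U φ =
      (∑ X ∈ (polys D.s univ).filter (fun X => reblock D.s (D.L * D.s) X = U),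
        bprod D.s (fun B => expNegH Ht B φ) (U \ X) *
          bprod D.s (fun B => expNegH (-Ht) B φ) (X \ U) *
          (fluct D.𝒞 (polyP2 D.s H K X) φ + bprod D.s (fun B => 1 - expNegH Ht B φ) X)) +
      ∑ X ∈ (polys D.s univ).filter (fun X => reblock D.s (D.L * D.s) X = U),
        ∑ X₁ ∈ ((polys D.s X).erase X).erase ∅,
          bprod D.s (fun B => expNegH Ht B φ) (U \ X) *
            bprod D.s (fun B => expNegH (-Ht) B φ) (X \ U) *
            (bprod D.s (fun B => 1 - expNegH Ht B φ) X₁ *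
              fluct D.𝒞 (polyP2 D.s H K (X \ X₁)) φ) := by
  rw [nextK_freeHt_eq_sum D H Ht K U φ hint, ← sum_add_distrib]
  refine sum_congr rfl fun X hX => ?_
  obtain ⟨hXp, hXU⟩ := mem_filter.1 hX
  have hXpoly : IsPolymer D.s X := (mem_polys.1 hXp).2
  have hXne : X.Nonempty := by
    rw [nonempty_iff_ne_empty]
    intro h
    rw [h, TorusPolymer.reblock_empty] at hXU
    exact hU.ne_empty hXU.symm
  have hXm : X ∈ polys D.s X := TorusPolymer.self_mem_polys hXpoly
  have h0m : (∅ : Finset (Fin d → ZMod M)) ∈ (polys D.s X).erase X :=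
    mem_erase.2 ⟨fun h => hXne.ne_empty h.symm, TorusPolymer.empty_mem_polys D.s X⟩
  rw [← add_sum_erase _ _ hXm, ← add_sum_erase _ _ h0m]
  rw [Finset.sdiff_self, polyP2_empty D.s H hK0, fluct_const, sdiff_empty, TorusPolymer.bprod_empty]
  ring

/-! ## `nextK − C_kK` with a free intermediate Hamiltonian: four second-order sums plus the defect -/

/-- **`nextK(μ_D; e^{−H}, e^{−H̃}, K)(U) − C_kK(U)` as an explicit sum, `H̃` free.**  Twin of
`nextKStep_sub_opC_eq` (same hypotheses): the single-block sum, the large connected sum, the disconnected sum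
and the `X₁`-sum, all with `H̃` in the prefactors `p_X(H̃) = (e^{−H̃})^{U∖X}(e^{H̃})^{X∖U}` and in the
`(1 − e^{−H̃})`-factors, PLUS the single-block defect `Σ_{B̄ = U} p_B(H̃)(e^{−H_{k+1}(B)} − e^{−H̃(B)})`,
`H_{k+1} = nextH D H K = A_kH + B_kK` (the first-order cancellation is exact only at `H̃ = H_{k+1}`).
[cite: AdamsBuchholzKoteckyMuller2019, Theorem 6.8 / Ch. 9.1] -/
theorem nextK_freeHt_sub_opC_eq (D : StepData d M) (hMo : Odd M) (hs : Odd D.s) (hL : Odd D.L)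
    (hC : (Matrix.circulant D.𝒞).PosSemidef) (hB₀ : D.B₀.card ≠ 0)
    (hroom : ∀ x ∈ D.B₀, HasRoom D.c₀ x (d / 2 + 1))
    (H Ht : RelevantHamiltonian ℂ d) (K : Finset (Fin d → ZMod M) → ((Fin d → ZMod M) → ℝ) → ℂ)
    (hK0 : ∀ φ, K ∅ φ = 1) {U : Finset (Fin d → ZMod M)} (hU : U.Nonempty) (φ : (Fin d → ZMod M) → ℝ)
    (hint : ∀ Z, IsPolymer D.s Z → Integrable (fun ξ => polyP2 D.s H K Z (φ + ξ)) (stepMeasure D.𝒞))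
    (hsplit : ∀ X ∈ (polys D.s univ).filter (fun X => reblock D.s (D.L * D.s) X = U),
      fluct D.𝒞 (polyP2 D.s H K X) φ =
        fluct D.𝒞 (K X) φ + fluct D.𝒞 (fun ψ => bprod D.s (fun B => expNegH H B ψ - 1) X) φ +
          fluct D.𝒞 (fun ψ => ∑ Y ∈ ((polys D.s X).erase X).erase ∅,
            bprod D.s (fun B => expNegH H B ψ - 1) (X \ Y) * K Y ψ) φ)
    (hI : ∀ B ∈ blockPartIndex D U, Integrable (fun ξ => expNegH H B (φ + ξ)) (stepMeasure D.𝒞)) :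
    nextK D.s (reblock D.s (D.L * D.s)) (stepMeasure D.𝒞) (expNegH H) (expNegH Ht) K U φ - opC D K U φ =
      (∑ B ∈ blockPartIndex D U,
        ((bprod D.s (fun B' => expNegH Ht B' φ) (U \ B) *
              bprod D.s (fun B' => expNegH (-Ht) B' φ) (B \ U) - 1) * blockTerm D K B φ +
          bprod D.s (fun B' => expNegH Ht B' φ) (U \ B) *
              bprod D.s (fun B' => expNegH (-Ht) B' φ) (B \ U) *
            (fluctDefect D.𝒞 H B φ +
              (expNegH (stepOpA (gradCov D.𝒞) H) B φ - 1) * (1 - Complex.exp (-(eval (opB D K) B φ))) -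
              (Complex.exp (-(eval (opB D K) B φ)) - 1 + eval (opB D K) B φ)) +
          bprod D.s (fun B' => expNegH Ht B' φ) (U \ B) *
              bprod D.s (fun B' => expNegH (-Ht) B' φ) (B \ U) *
            fluct D.𝒞 (fun ψ => ∑ Y ∈ ((polys D.s B).erase B).erase ∅,
              bprod D.s (fun B' => expNegH H B' ψ - 1) (B \ Y) * K Y ψ) φ)) +
      (∑ X ∈ largePartIndex D.s D.L U,
        ((bprod D.s (fun B' => expNegH Ht B' φ) (U \ X) *
              bprod D.s (fun B' => expNegH (-Ht) B' φ) (X \ U) - 1) * fluct D.𝒞 (K X) φ +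
          bprod D.s (fun B' => expNegH Ht B' φ) (U \ X) *
              bprod D.s (fun B' => expNegH (-Ht) B' φ) (X \ U) *
            (fluct D.𝒞 (fun ψ => bprod D.s (fun B => expNegH H B ψ - 1) X) φ +
              fluct D.𝒞 (fun ψ => ∑ Y ∈ ((polys D.s X).erase X).erase ∅,
                bprod D.s (fun B => expNegH H B ψ - 1) (X \ Y) * K Y ψ) φ +
              bprod D.s (fun B => 1 - expNegH Ht B φ) X))) +
      (∑ X ∈ ((polys D.s univ).filter (fun X => reblock D.s (D.L * D.s) X = U)).filter (fun X => ¬ IsConn X),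
        bprod D.s (fun B' => expNegH Ht B' φ) (U \ X) *
            bprod D.s (fun B' => expNegH (-Ht) B' φ) (X \ U) *
          (fluct D.𝒞 (polyP2 D.s H K X) φ + bprod D.s (fun B => 1 - expNegH Ht B φ) X)) +
      (∑ X ∈ (polys D.s univ).filter (fun X => reblock D.s (D.L * D.s) X = U),
        ∑ X₁ ∈ ((polys D.s X).erase X).erase ∅,
          bprod D.s (fun B => expNegH Ht B φ) (U \ X) *
            bprod D.s (fun B => expNegH (-Ht) B φ) (X \ U) *
            (bprod D.s (fun B => 1 - expNegH Ht B φ) X₁ *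
              fluct D.𝒞 (polyP2 D.s H K (X \ X₁)) φ)) +
      ∑ B ∈ blockPartIndex D U,
        bprod D.s (fun B' => expNegH Ht B' φ) (U \ B) *
            bprod D.s (fun B' => expNegH (-Ht) B' φ) (B \ U) *
          (expNegH (nextH D H K) B φ - expNegH Ht B φ) := by
  set 𝓧 := (polys D.s univ).filter (fun X => reblock D.s (D.L * D.s) X = U) with h𝓧
  -- abbreviations for the prefactor and the pieces
  set p : Finset (Fin d → ZMod M) → ℂ := fun X =>
    bprod D.s (fun B' => expNegH Ht B' φ) (U \ X) *
      bprod D.s (fun B' => expNegH (-Ht) B' φ) (X \ U) with hp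
  set J : Finset (Fin d → ZMod M) → ℂ := fun X => bprod D.s (fun B => 1 - expNegH Ht B φ) X with hJ
  set RP : Finset (Fin d → ZMod M) → ℂ := fun X => fluct D.𝒞 (polyP2 D.s H K X) φ with hRP
  set RK : Finset (Fin d → ZMod M) → ℂ := fun X => fluct D.𝒞 (K X) φ with hRK
  set RE : Finset (Fin d → ZMod M) → ℂ := fun X =>
    fluct D.𝒞 (fun ψ => bprod D.s (fun B => expNegH H B ψ - 1) X) φ with hRE
  set Rr : Finset (Fin d → ZMod M) → ℂ := fun X =>
    fluct D.𝒞 (fun ψ => ∑ Y ∈ ((polys D.s X).erase X).erase ∅,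
      bprod D.s (fun B => expNegH H B ψ - 1) (X \ Y) * K Y ψ) φ with hRr
  set dfc : Finset (Fin d → ZMod M) → ℂ := fun B => expNegH (nextH D H K) B φ - expNegH Ht B φ with hdfc
  -- the outer split and the three-way split of the first sum
  rw [nextK_freeHt_eq_split D H Ht K hK0 hU φ hint]
  have hthree := sum_filter_reblock_eq_three D hMo hs hL U (fun X => p X * (RP X + J X))
  -- blocks: the first-order cancellation at `H̃ = H_{k+1}` and the defect
  have hblk : ∀ B ∈ blockPartIndex D U, p B * (RP B + J B) = (blockTerm D K B φ +
      ((p B - 1) * blockTerm D K B φ +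
        p B * (fluctDefect D.𝒞 H B φ +
          (expNegH (stepOpA (gradCov D.𝒞) H) B φ - 1) * (1 - Complex.exp (-(eval (opB D K) B φ))) -
          (Complex.exp (-(eval (opB D K) B φ)) - 1 + eval (opB D K) B φ)) + p B * Rr B)) + p B * dfc B := by
    intro B hB
    have hB𝓧 : B ∈ 𝓧 := by
      have : B ∈ 𝓧.filter (fun X => IsConn X ∧ (blocks D.s X).card = 1) := by
        rw [h𝓧, filter_reblock_isConn_card_eq_one D hMo hs hL U]; exact hB
      exact mem_of_mem_filter _ this
    obtain ⟨hBb, hcl⟩ := mem_filter.1 hB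
    obtain ⟨x, -, rfl⟩ := mem_blocks.1 hBb
    have hRPB : RP (blockOf D.s x) = RK (blockOf D.s x) +
        fluct D.𝒞 (fun ψ => expNegH H (blockOf D.s x) ψ - 1) φ + Rr (blockOf D.s x) := by
      have h := hsplit _ hB𝓧
      have hfun : (fun ψ => bprod D.s (fun B => expNegH H B ψ - 1) (blockOf D.s x)) =
          fun ψ => expNegH H (blockOf D.s x) ψ - 1 := by
        funext ψ; exact bprod_blockOf D.s _ x
      rw [hfun] at h
      exact h
    have hJB : J (blockOf D.s x) = 1 - expNegH Ht (blockOf D.s x) φ := bprod_blockOf D.s _ x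
    rw [hRPB, hJB]
    have hfo := firstOrder_block_identity D hC hB₀ hroom H K (blockOf D.s x) φ (p (blockOf D.s x)) (hI _ hB)
    rw [blockTerm] at hfo ⊢
    simp only [hdfc]
    linear_combination hfo
  -- large connected polymers
  have hlrg : ∀ X ∈ largePartIndex D.s D.L U, p X * (RP X + J X) = RK X +
      ((p X - 1) * RK X + p X * (RE X + Rr X + J X)) := by
    intro X hX
    have hX𝓧 : X ∈ 𝓧 := by
      have : X ∈ 𝓧.filter (fun X => IsConn X ∧ 2 ≤ (blocks D.s X).card) := by
        rw [h𝓧, filter_reblock_isConn_two_le D U]; exact hX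
      exact mem_of_mem_filter _ this
    rw [show RP X = RK X + RE X + Rr X from hsplit X hX𝓧]
    ring
  -- assemble
  rw [hthree, sum_congr rfl hblk, sum_add_distrib (f := fun B => blockTerm D K B φ +
      ((p B - 1) * blockTerm D K B φ +
        p B * (fluctDefect D.𝒞 H B φ +
          (expNegH (stepOpA (gradCov D.𝒞) H) B φ - 1) * (1 - Complex.exp (-(eval (opB D K) B φ))) -
          (Complex.exp (-(eval (opB D K) B φ)) - 1 + eval (opB D K) B φ)) + p B * Rr B)),
    sum_add_distrib (f := fun B => blockTerm D K B φ),
    sum_congr rfl hlrg, sum_add_distrib (f := fun X => RK X)]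
  unfold opC blockPart largePart
  simp only [hp, hJ, hRP, hRK, hRE, hRr, hdfc, h𝓧]
  ring

/-! ## The torus discharge: `blockPart + Σ₁(H̃) + Σ₂ᴸ(H̃) + Σ₃(H̃) + Σ₄(H̃) + Σ₀(H̃)` -/

set_option maxHeartbeats 800000 in
/-- **`nextK(μ_{k+1}; e^{−H}, e^{−H̃}, K)(U) = blockPart(C_kK)(U) + Σ₁(H̃) + Σ₂ᴸ(H̃) + Σ₃(H̃) + Σ₄(H̃) + Σ₀(H̃)`
for the torus data with a kernel by predicate** (twin of
`nextKStep_eq_blockPart_add_remainders_abkm_of_stepKernelBounds`, `H̃` free): `d ≥ 2`, `L` odd,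
`L ≥ 2^{d+3}+16R`, `M = L^N`, `k+1 ≤ N`, `p ≤ R`, `⌊d/2⌋+1 ≤ min(p, M_ord)`, `δ₀, δ₁ > 0`, `h² ≥ h₀²`, `A > 0`;
step data `D` with `D.s = L^k`, `D.L = L`, `StepKernelBounds` for `D.𝒞`, reference block `B_{x₀}` with its box
corner; `‖H‖_{k,0} ≤ 1/8`; `K` admissible with `K(∅) = 1`; `U ≠ ∅`.  The four sums are literally the free-`H̃`
arguments of the remainder theorems of `RenormalisationMapRemaindersOneQ/TwoQ` and of the kernel-only twins;
`Σ₀(H̃) = Σ_{B̄ = U} p_B(H̃)(e^{−H_{k+1}(B)} − e^{−H̃(B)})` is the single-block defect.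
[cite: AdamsBuchholzKoteckyMuller2019, Theorem 6.8 / Ch. 9.1 / Ch. 10.1 (10.1)–(10.3)] -/
theorem nextK_freeHt_eq_blockPart_add_remainders_abkm_of_stepKernelBounds {L N Mord R n p r₀ : ℕ}
    {θbar lam μ δ₁ δ₀ A𝒫 A𝒫' C₂ h A : ℝ}
    {𝒞 : ℕ → (Fin d → ZMod M) → ℝ} (hd : 2 ≤ d) (hLodd : Odd L) (hL : 2 ^ (d + 3) + 16 * R ≤ L)
    (hM : M = L ^ N) {k : ℕ} (hkN : k + 1 ≤ N) (hp : d / 2 + 1 ≤ p) (hpR : p ≤ R) (hMord : d / 2 + 1 ≤ Mord)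
    (hB : AbkmWeightBounds L N Mord R n θbar lam μ δ₁ δ₀ A𝒫 𝒞
      (abkmWeightData L N Mord R θbar (schedDelta δ₀ δ₁ N) 𝒞))
    (hδ₀ : 0 < δ₀) (hδ₁ : 0 < δ₁) (hh : 0 < h) (hh0 : hZeroSq d R δ₀ δ₁ ≤ h ^ 2) (hA : 0 < A)
    (D : StepData d M) (hDs : D.s = L ^ k) (hDL : D.L = L)
    (hS : StepKernelBounds (abkmWeightData L N Mord R θbar (schedDelta δ₀ δ₁ N) 𝒞) L k A𝒫' C₂ D.𝒞)
    {x₀ : Fin d → ZMod M} (hB₀ : D.B₀ = blockOf (L ^ k) x₀) (hc₀ : D.c₀ = boxCorner (L ^ k) (starRad R L d k) x₀)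
    {H : RelevantHamiltonian ℂ d}
    (hH : hamNorm (fieldWt h (L : ℝ) d k) ((L : ℝ) ^ k) (L ^ (d * k)) H ≤ 1 / 8)
    (Ht : RelevantHamiltonian ℂ d)
    {K : Finset (Fin d → ZMod M) → ((Fin d → ZMod M) → ℝ) → ℂ} {C : ℝ} (hC : 0 ≤ C)
    (hK : WeakNormLE (abkmNormParams L N Mord R p r₀ h θbar A (schedDelta δ₀ δ₁ N) 𝒞) k K C)
    (hKfac : Factorises (L ^ k) K) (hK0 : ∀ φ, K ∅ φ = 1) (hKd : ∀ Y, ContDiff ℝ r₀ (K Y))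
    (hKloc : ∀ Y, IsPolymer (L ^ k) Y → IsConn Y →
      IsGaugeLocal ((abkmNormParams L N Mord R p r₀ h θbar A (schedDelta δ₀ δ₁ N) 𝒞).gauge k Y) (K Y))
    {U : Finset (Fin d → ZMod M)} (hUne : U.Nonempty) (φ : (Fin d → ZMod M) → ℝ) :
    nextK D.s (reblock D.s (D.L * D.s)) (stepMeasure D.𝒞) (expNegH H) (expNegH Ht) K U φ =
      blockPart D K U φ +
      (∑ B ∈ blockPartIndex D U,
        ((bprod (L ^ k) (fun B' => expNegH Ht B' φ) (U \ B) *
              bprod (L ^ k) (fun B' => expNegH (-Ht) B' φ) (B \ U) - 1) * blockTerm D K B φ +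
          bprod (L ^ k) (fun B' => expNegH Ht B' φ) (U \ B) *
              bprod (L ^ k) (fun B' => expNegH (-Ht) B' φ) (B \ U) *
            (fluctDefect D.𝒞 H B φ +
              (expNegH (stepOpA (gradCov D.𝒞) H) B φ - 1) * (1 - Complex.exp (-(eval (opB D K) B φ))) -
              (Complex.exp (-(eval (opB D K) B φ)) - 1 + eval (opB D K) B φ)) +
          bprod (L ^ k) (fun B' => expNegH Ht B' φ) (U \ B) *
              bprod (L ^ k) (fun B' => expNegH (-Ht) B' φ) (B \ U) *
            fluct D.𝒞 (fun ψ => ∑ Y ∈ ((polys (L ^ k) B).erase B).erase ∅,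
              bprod (L ^ k) (fun B' => expNegH H B' ψ - 1) (B \ Y) * K Y ψ) φ)) +
      (∑ X ∈ largePartIndex (L ^ k) L U,
        bprod (L ^ k) (fun B => expNegH Ht B φ) (U \ X) *
            bprod (L ^ k) (fun B => expNegH (-Ht) B φ) (X \ U) *
          (fluct D.𝒞 (polyP2 (L ^ k) H K X) φ + bprod (L ^ k) (fun B => 1 - expNegH Ht B φ) X)) +
      (∑ X ∈ ((polys (L ^ k) univ).filter (fun X => reblock (L ^ k) (L * L ^ k) X = U)).filter
          (fun X => ¬ IsConn X),
        bprod (L ^ k) (fun B => expNegH Ht B φ) (U \ X) *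
            bprod (L ^ k) (fun B => expNegH (-Ht) B φ) (X \ U) *
          (fluct D.𝒞 (polyP2 (L ^ k) H K X) φ + bprod (L ^ k) (fun B => 1 - expNegH Ht B φ) X)) +
      (∑ X ∈ (polys (L ^ k) univ).filter (fun X => reblock (L ^ k) (L * L ^ k) X = U),
        ∑ X₁ ∈ ((polys (L ^ k) X).erase X).erase ∅,
          bprod (L ^ k) (fun B => expNegH Ht B φ) (U \ X) *
            bprod (L ^ k) (fun B => expNegH (-Ht) B φ) (X \ U) *
            (bprod (L ^ k) (fun B => 1 - expNegH Ht B φ) X₁ *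
              fluct D.𝒞 (polyP2 (L ^ k) H K (X \ X₁)) φ)) +
      ∑ B ∈ blockPartIndex D U,
        bprod (L ^ k) (fun B' => expNegH Ht B' φ) (U \ B) *
            bprod (L ^ k) (fun B' => expNegH (-Ht) B' φ) (B \ U) *
          (expNegH (nextH D H K) B φ - expNegH Ht B φ) := by
  set P := abkmNormParams L N Mord R p r₀ h θbar A (schedDelta δ₀ δ₁ N) 𝒞 with hP
  set W := abkmWeightData L N Mord R θbar (schedDelta δ₀ δ₁ N) 𝒞 with hW
  have hL0 : (0 : ℝ) < L := by exact_mod_cast hLodd.pos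
  have hk1 : k + 1 ≤ N + 1 := by omega
  have hk : k ≤ N := by omega
  have hMo : Odd M := by rw [hM]; exact hLodd.pow
  have hsodd : Odd (L ^ k) := hLodd.pow
  obtain ⟨t, ht⟩ : ∃ t, N = k + t := ⟨N - k, by omega⟩
  have hMt : M = L ^ k * L ^ t := by rw [← pow_add, ← ht]; exact hM
  have htodd : Odd (L ^ t) := hLodd.pow
  have h𝔥 : 0 < fieldWt h (L : ℝ) d k := fieldWt_pos hh hL0 d k
  have hRk : (0 : ℝ) < (L : ℝ) ^ k := by positivity
  -- the step data is the concrete one: substitute its fields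
  obtain ⟨s, L', 𝒸, c₀, B₀⟩ := D
  simp only at hDs hDL hS hB₀ hc₀
  subst s L' c₀ B₀
  -- the hypotheses of `nextK_freeHt_sub_opC_eq`
  have hC𝒞 : (Matrix.circulant 𝒸).PosSemidef := hS.posSemidef
  have hBne : (blockOf (L ^ k) x₀ : Finset (Fin d → ZMod M)).card ≠ 0 :=
    (card_pos.2 ⟨x₀, TorusPolymer.mem_blockOf_self _ x₀⟩).ne'
  obtain ⟨hwrap0, hroom0⟩ := abkm_box_lt (d := d) hL hpR hkN
  have hwrap : 4 * ((L ^ k - 1) / 2 + starRad R L d k) < M := by rw [hM]; exact hwrap0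
  have hroomB : ∀ x ∈ blockOf (L ^ k) x₀, HasRoom (boxCorner (L ^ k) (starRad R L d k) x₀) x (d / 2 + 1) := by
    intro x hx
    have hxS : x ∈ thicken (starRad R L d k) (blockOf (L ^ k) x₀) := subset_thicken _ _ hx
    have hin := (TorusPolymer.mem_thicken_blockOf_iff_inBox hMt hLodd.pow htodd hwrap x₀ x).1 hxS
    refine TorusPolymer.hasRoom_of_inBox hin ?_
    have h2 : ((2 * ((L ^ k - 1) / 2 + starRad R L d k) : ℕ) + ((d / 2 + 1 : ℕ) : ℤ)) * 2 < (M : ℤ) := by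
      have : (2 * ((L ^ k - 1) / 2 + starRad R L d k) + (d / 2 + 1)) * 2 < M := by
        rw [hM]; have := hroom0; omega
      exact_mod_cast this
    exact_mod_cast h2
  -- integrability of `P₂(Z, φ + ·)`
  have hint : ∀ Z, IsPolymer (L ^ k) Z →
      Integrable (fun ξ => polyP2 (L ^ k) H K Z (φ + ξ)) (stepMeasure 𝒸) := by
    intro Z hZ
    have hb := tayNormLE_polyP2_abkm (p := p) (r₀ := r₀) hd hLodd hM hkN hp hMord hB hδ₀ hδ₁ hh hh0 hA hZ hH hC hK
      hKfac hK0 hKd hKloc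
    have hc : 0 ≤ ∑ Y ∈ polys (L ^ k) Z, (∏ _B ∈ blocks (L ^ k) (Z \ Y),
        8 * Real.exp (1 / 4) * hamNorm (fieldWt h (L : ℝ) d k) ((L : ℝ) ^ k) (L ^ (d * k)) H) *
        ∏ Z' ∈ components Y, C * P.aFactor k Z' := by
      refine sum_nonneg fun Y _ => mul_nonneg (prod_nonneg fun _ _ => ?_) (prod_nonneg fun Z' _ => ?_)
      · have := hamNorm_nonneg h𝔥.le hRk.le (L ^ (d * k)) H; positivity
      · exact mul_nonneg hC (WeakNormLE.aFactor_pos hA k Z').le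
    exact integrable_comp_add_of_tayNormLE hb hc (contDiff_polyP2 (L ^ k) H hKd Z)
      (isGaugeLocal_polyP2_abkm (p := p) (r₀ := r₀) (θbar := θbar) (A := A) (δ := schedDelta δ₀ δ₁ N) (𝒞 := 𝒞)
        (N := N) (Mord := Mord) (R := R) hLodd hM hk hh hp H hKfac hK0 hKloc hZ)
      (hS.weightSectionDominated hB.dominated Z (P.gauge k Z)) φ
  -- the split of `R[P₂(X)]`
  have hsplit : ∀ X ∈ (polys (L ^ k) univ).filter (fun X => reblock (L ^ k) (L * L ^ k) X = U),
      fluct 𝒸 (polyP2 (L ^ k) H K X) φ =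
        fluct 𝒸 (K X) φ + fluct 𝒸 (fun ψ => bprod (L ^ k) (fun B => expNegH H B ψ - 1) X) φ +
          fluct 𝒸 (fun ψ => ∑ Y ∈ ((polys (L ^ k) X).erase X).erase ∅,
            bprod (L ^ k) (fun B => expNegH H B ψ - 1) (X \ Y) * K Y ψ) φ := by
    intro X hX
    obtain ⟨hXp, hXU⟩ := mem_filter.1 hX
    have hXpoly : IsPolymer (L ^ k) X := (mem_polys.1 hXp).2
    have hXne : X.Nonempty := by
      rw [nonempty_iff_ne_empty]
      intro h0
      rw [h0, reblock_empty] at hXU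
      exact hUne.ne_empty hXU.symm
    exact fluct_polyP2_eq_add_add_rest_abkm_of_stepKernelBounds hd hLodd hM hkN hS hp hMord hB hδ₀ hδ₁ hh hh0 hA hXpoly hXne hH
      hC hK hKfac hK0 hKd hKloc φ
  -- integrability of `e^{−H(B, φ+·)}` on blocks
  have hI : ∀ B ∈ blockPartIndex (⟨L ^ k, L, 𝒸, boxCorner (L ^ k) (starRad R L d k) x₀, blockOf (L ^ k) x₀⟩ :
        StepData d M) U,
      Integrable (fun ξ => expNegH H B (φ + ξ)) (stepMeasure 𝒸) := by
    intro B hB'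
    have hBb := blockPartIndex_subset_blocks _ U hB'
    obtain ⟨y, -, rfl⟩ := mem_blocks.1 hBb
    have hBS : blockOf (L ^ k) y ⊆ thicken (P.rad k) (blockOf (L ^ k) y) := subset_thicken _ _
    have hcard : (blockOf (L ^ k) y).card = L ^ (d * k) := by
      rw [TorusPolymer.card_blockOf hMt hLodd.pow htodd y, ← pow_mul, mul_comm]
    have hHB : hamNorm (fieldWt h (L : ℝ) d k) ((L : ℝ) ^ k) (blockOf (L ^ k) y).card H ≤ 1 / 8 := by
      rw [hcard]; exact hH
    have hs := tayNormLE_expNegH_strong_abkm (R := R) (Mord := Mord) hd hLodd hM hk hh hMord hp hBS r₀ hHB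
    have hgauge : P.gauge k (blockOf (L ^ k) y) =
        fieldGauge (fieldWt h (L : ℝ) d k) ((L : ℝ) ^ k) p (thicken (P.rad k) (blockOf (L ^ k) y)) := rfl
    rw [← hgauge] at hs
    have hSW : ∀ ψ, expWeight (strongCoef h N k • derivForm (L : ℝ) k (diffIndex d Mord)
        (boxDensity (boxRad R L k) (boxWt (L : ℝ) d k) (blockOf (L ^ k) y))) ψ ≤ W.weight k (blockOf (L ^ k) y) ψ :=
      fun ψ => strongWeight_le_weight_abkm hB hδ₀ hδ₁ hh hh0 k (subset_refl _) ψ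
    have hev : IsGaugeLocal (P.gauge k (blockOf (L ^ k) y)) (fun φ : (Fin d → ZMod M) → ℝ => eval H (blockOf (L ^ k) y) φ) := by
      rw [hgauge]; exact isGaugeLocal_eval h𝔥.ne' hRk.ne' hp hBS H
    have hexp_loc : IsGaugeLocal (P.gauge k (blockOf (L ^ k) y)) (expNegH H (blockOf (L ^ k) y)) :=
      fun φ ψ hT => by simp only [expNegH, hev φ ψ hT]
    have hexp_d : ContDiff ℝ r₀ (expNegH H (blockOf (L ^ k) y)) := by
      show ContDiff ℝ r₀ (fun φ : (Fin d → ZMod M) → ℝ => Complex.exp (-(eval H (blockOf (L ^ k) y) φ)))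
      exact (contDiff_eval H _ (n := r₀)).neg.cexp
    exact integrable_comp_add_of_tayNormLE (hs.mono_weight (Real.exp_pos _).le hSW) (Real.exp_pos _).le hexp_d hexp_loc
      (hS.weightSectionDominated hB.dominated _ (P.gauge k _)) φ
  -- the identity with the defect, and the regrouping of the second sum
  have hmain := nextK_freeHt_sub_opC_eq ⟨L ^ k, L, 𝒸, boxCorner (L ^ k) (starRad R L d k) x₀, blockOf (L ^ k) x₀⟩
    hMo hsodd hLodd hC𝒞 hBne hroomB H Ht K hK0 hUne φ hint hsplit hI
  simp only at hmain
  have hlarge : ∀ X ∈ largePartIndex (L ^ k) L U,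
      fluct 𝒸 (polyP2 (L ^ k) H K X) φ =
        fluct 𝒸 (K X) φ + fluct 𝒸 (fun ψ => bprod (L ^ k) (fun B => expNegH H B ψ - 1) X) φ +
          fluct 𝒸 (fun ψ => ∑ Y ∈ ((polys (L ^ k) X).erase X).erase ∅,
            bprod (L ^ k) (fun B => expNegH H B ψ - 1) (X \ Y) * K Y ψ) φ := by
    intro X hX
    obtain ⟨hXp, -, -, hXU⟩ := mem_largePartIndex.1 hX
    exact hsplit X (mem_filter.2 ⟨mem_polys.2 ⟨subset_univ _, hXp⟩, hXU⟩)
  have hreg := sum_large_regroup (largePartIndex (L ^ k) L U)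
    (fun X => bprod (L ^ k) (fun B => expNegH Ht B φ) (U \ X) *
      bprod (L ^ k) (fun B => expNegH (-Ht) B φ) (X \ U))
    (fun X => fluct 𝒸 (K X) φ)
    (fun X => fluct 𝒸 (fun ψ => bprod (L ^ k) (fun B => expNegH H B ψ - 1) X) φ)
    (fun X => fluct 𝒸 (fun ψ => ∑ Y ∈ ((polys (L ^ k) X).erase X).erase ∅,
      bprod (L ^ k) (fun B => expNegH H B ψ - 1) (X \ Y) * K Y ψ) φ)
    (fun X => bprod (L ^ k) (fun B => 1 - expNegH Ht B φ) X)
    (fun X => fluct 𝒸 (polyP2 (L ^ k) H K X) φ) hlarge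
  rw [hreg] at hmain
  have hopC : opC ⟨L ^ k, L, 𝒸, boxCorner (L ^ k) (starRad R L d k) x₀, blockOf (L ^ k) x₀⟩ K U φ =
      blockPart ⟨L ^ k, L, 𝒸, boxCorner (L ^ k) (starRad R L d k) x₀, blockOf (L ^ k) x₀⟩ K U φ +
        ∑ X ∈ largePartIndex (L ^ k) L U, fluct 𝒸 (K X) φ := rfl
  rw [hopC] at hmain
  linear_combination hmain

/-- **At `H̃ = H_{k+1} = nextH D H K` the defect vanishes** (each summand is `p_B·(e^{−H_{k+1}(B)} − e^{−H_{k+1}(B)}) = 0`),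
so the free-`H̃` decomposition reduces to the tied one. [cite: AdamsBuchholzKoteckyMuller2019, Theorem 6.8 / Ch. 9.1] -/
theorem sum_blockPartIndex_defect_nextH_eq_zero (D : StepData d M) (s : ℕ) (H : RelevantHamiltonian ℂ d)
    (K : Finset (Fin d → ZMod M) → ((Fin d → ZMod M) → ℝ) → ℂ) (U : Finset (Fin d → ZMod M))
    (φ : (Fin d → ZMod M) → ℝ) :
    ∑ B ∈ blockPartIndex D U,
        bprod s (fun B' => expNegH (nextH D H K) B' φ) (U \ B) *
            bprod s (fun B' => expNegH (-(nextH D H K)) B' φ) (B \ U) *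
          (expNegH (nextH D H K) B φ - expNegH (nextH D H K) B φ) = 0 := by
  simp

end Literature.MathematicalPhysics.StatisticalMechanics.GradientRG

end
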